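import Summits.SmoothPoincare4.SmoothPoincare4.Theses.EinsteinBulk
import Literature.Geometry.Riemannian.SimpleAHBoundarySphereProofs

/-!
# Birth skeleton of the piece `HadamardFillingNonTrapping` (split child of crux
# `EinsteinBulk.EinsteinHadamardFillingStandard`, item stmt-SmoothPoincare4-7999)

Two stubs and the kernel-checked composition:

* `stub_simplyConnected_of_hadamardFilling` — THE TOPOLOGICAL HEART: a `C²`-conformally compact
  `K ≤ 0` filling `N⁵` of a homotopy `4`-sphere `M` is simply connected (Cartan–Hadamard covering
  `exp_p : ℝ⁵ → N` + the `ρ`-collar `≅ M × (0,a)` as a simply connected sheet with compact frontier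
  and non-compact closure + one end of `ℝ⁵`: the landed `stub_coverSheetsSimplyConnected`,
  `stub_euclideanOneEnd`, `SimpleAH.exp_covering_of_complete`, `SimpleAH.exists_openCollarData_of_bdf`).
* `stub_nonTrapping_of_simplyConnected` — HADAMARD MANIFOLDS ARE NON-TRAPPING: complete, simply
  connected, `K ≤ 0` ⇒ `exp_p` is a diffeomorphism (covering + simply connected base), so the ray
  `t ↦ exp_p (t v)` leaves the compact set `exp_p⁻¹ K`.
* `HadamardFillingNonTrapping_of` — the piece from the two stubs; the glue derives completeness of
  `g` from the package (`SimpleAH.isGeodesicallyComplete_of_conformallyCompact`, landed).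
-/

noncomputable section

set_option linter.dupNamespace false

open Bundle Set Filter Function Metric TopologicalSpace
open scoped Manifold ContDiff Topology ContinuousMap

namespace Summit.SmoothPoincare4.SmoothPoincare4.Cruxes.EinsteinHadamardFillingStandard.GgsuC2Redirect

open Literature.Geometry.Lorentzian Literature.Geometry.Lorentzian.PseudoRiemannianMetric
  Literature.Geometry.Riemannian Literature.Geometry.Riemannian.SimpleAH

/-- The piece (verbatim the would-be route decl `EinsteinBulk.HadamardFillingNonTrapping`). -/
def HadamardFillingNonTrapping : Prop :=
  ∀ (M : Type) [TopologicalSpace M] [T2Space M] [SecondCountableTopology M] [ChartedSpace (EuclideanSpace ℝ (Fin 4)) M] [IsManifold (𝓡 4) ∞ M] [CompactSpace M], M ≃ₕ Metric.sphere (0 : EuclideanSpace ℝ (Fin 5)) 1 → ∀ (N : Type) [TopologicalSpace N] [T2Space N] [SecondCountableTopology N] [ChartedSpace (EuclideanSpace ℝ (Fin 5)) N] [IsManifold (𝓡 5) ∞ N] (g : Bundle.ContMDiffRiemannianMetric (𝓡 5) ∞ (EuclideanSpace ℝ (Fin 5)) (TangentSpace (𝓡 5) : N → Type _)) [(Literature.Geometry.Lorentzian.PseudoRiemannianMetric.ofRiemannian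 g).HasLeviCivita], (∃ (X : Type) (_ : TopologicalSpace X) (_ : T2Space X) (_ : SecondCountableTopology X) (_ : ChartedSpace (EuclideanHalfSpace 5) X) (_ : IsManifold (𝓡∂ 5) ∞ X) (_ : CompactSpace X) (_ : ConnectedSpace X) (j : N → X) (ι : M → X) (ρ : X → ℝ) (gb : Bundle.ContMDiffRiemannianMetric (𝓡∂ 5) 2 (EuclideanSpace ℝ (Fin 5)) (TangentSpace (𝓡∂ 5) : X → Type _)), Manifold.IsSmoothEmbedding (𝓡 5) (𝓡∂ 5) ∞ j ∧ Set.range j = (𝓡∂ 5).interior X ∧ Manifold.IsSmoothEmbedding (𝓡 4) (𝓡∂ 5) ∞ ι ∧ Set.range ι = (𝓡∂ 5).boundary X ∧ ContMDiff (𝓡∂ 5) 𝓘(ℝ, ℝ) ∞ ρ ∧ (∀ x : X, 0 ≤ ρ x) ∧ (∀ x : X, ρ x = 0 ↔ x ∈ (𝓡∂ 5).boundary X) ∧ (∀ y : M, ∃ ν : TangentSpace (𝓡∂ 5) (ι y), gb.inner (ι y) ν ν = 1 ∧ ∀ v : TangentSpace (𝓡∂ 5) (ι y), gb.inner (ι y)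 ν v = mfderiv (𝓡∂ 5) 𝓘(ℝ, ℝ) ρ (ι y) v) ∧ (∀ (x : N) (v w : TangentSpace (𝓡 5) x), gb.inner (j x) (mfderiv (𝓡 5) (𝓡∂ 5) j x v) (mfderiv (𝓡 5) (𝓡∂ 5) j x w) = ρ (j x) ^ 2 * g.inner x v w)) → (∀ (x : N) (X Y : TangentSpace (𝓡 5) x), g.inner x X X = 1 → g.inner x Y Y = 1 → g.inner x X Y = 0 → (Literature.Geometry.Lorentzian.PseudoRiemannianMetric.ofRiemannian g).curvatureForm (Literature.Geometry.Lorentzian.PseudoRiemannianMetric.ofRiemannian g).leviCivita x X Y Y X ≤ 0) → ∀ γ : ℝ → N, Literature.Geometry.Lorentzian.IsGeodesic (Literature.Geometry.Lorentzian.PseudoRiemannianMetric.ofRiemannian g).leviCivita γ → Literature.Geometry.Lorentzian.velocity (𝓡 5) γ 0 ≠ 0 → ∀ K : Set N, IsCompact K → ∃ T : ℝ, ∀ t : ℝ, T ≤ t → γ t ∉ K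

/-- Stub 1 (topological heart): the bulk of a `C²`-conformally compact `K ≤ 0` filling of a
homotopy `4`-sphere is simply connected. [cite: GrahamEtAl2020, p. 10] -/
theorem stub_simplyConnected_of_hadamardFilling
    (M : Type) [TopologicalSpace M] [T2Space M] [SecondCountableTopology M]
    [ChartedSpace (EuclideanSpace ℝ (Fin 4)) M] [IsManifold (𝓡 4) ∞ M] [CompactSpace M]
    (he : M ≃ₕ Metric.sphere (0 : EuclideanSpace ℝ (Fin 5)) 1)
    (N : Type) [TopologicalSpace N] [T2Space N] [SecondCountableTopology N]
    [ChartedSpace (EuclideanSpace ℝ (Fin 5)) N] [IsManifold (𝓡 5) ∞ N]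
    (g : Bundle.ContMDiffRiemannianMetric (𝓡 5) ∞ (EuclideanSpace ℝ (Fin 5))
      (TangentSpace (𝓡 5) : N → Type _))
    [(PseudoRiemannianMetric.ofRiemannian g).HasLeviCivita]
    (hpack : ∃ (X : Type) (_ : TopologicalSpace X) (_ : T2Space X) (_ : SecondCountableTopology X)
        (_ : ChartedSpace (EuclideanHalfSpace 5) X) (_ : IsManifold (𝓡∂ 5) ∞ X)
        (_ : CompactSpace X) (_ : ConnectedSpace X) (j : N → X) (ι : M → X) (ρ : X → ℝ)
        (gb : Bundle.ContMDiffRiemannianMetric (𝓡∂ 5) 2 (EuclideanSpace ℝ (Fin 5))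
          (TangentSpace (𝓡∂ 5) : X → Type _)),
        Manifold.IsSmoothEmbedding (𝓡 5) (𝓡∂ 5) ∞ j ∧ Set.range j = (𝓡∂ 5).interior X ∧
        Manifold.IsSmoothEmbedding (𝓡 4) (𝓡∂ 5) ∞ ι ∧ Set.range ι = (𝓡∂ 5).boundary X ∧
        ContMDiff (𝓡∂ 5) 𝓘(ℝ, ℝ) ∞ ρ ∧ (∀ x : X, 0 ≤ ρ x) ∧
        (∀ x : X, ρ x = 0 ↔ x ∈ (𝓡∂ 5).boundary X) ∧
        (∀ y : M, ∃ ν : TangentSpace (𝓡∂ 5) (ι y), gb.inner (ι y) ν ν = 1 ∧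
          ∀ v : TangentSpace (𝓡∂ 5) (ι y),
            gb.inner (ι y) ν v = mfderiv (𝓡∂ 5) 𝓘(ℝ, ℝ) ρ (ι y) v) ∧
        (∀ (x : N) (v w : TangentSpace (𝓡 5) x),
          gb.inner (j x) (mfderiv (𝓡 5) (𝓡∂ 5) j x v) (mfderiv (𝓡 5) (𝓡∂ 5) j x w) =
            ρ (j x) ^ 2 * g.inner x v w))
    (hsec : ∀ (x : N) (X Y : TangentSpace (𝓡 5) x), g.inner x X X = 1 → g.inner x Y Y = 1 →
        g.inner x X Y = 0 →
        (PseudoRiemannianMetric.ofRiemannian g).curvatureForm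
          (PseudoRiemannianMetric.ofRiemannian g).leviCivita x X Y Y X ≤ 0) :
    SimplyConnectedSpace N := by
  sorry

/-- Stub 2: a complete simply connected Riemannian `5`-manifold with `K ≤ 0` is non-trapping
(Cartan–Hadamard: `exp_p` is a diffeomorphism; rays leave the compact `exp_p⁻¹ K`).
[cite: Lee2018, Thm. 12.8] -/
theorem stub_nonTrapping_of_simplyConnected
    (N : Type) [TopologicalSpace N] [T2Space N] [SecondCountableTopology N]
    [ChartedSpace (EuclideanSpace ℝ (Fin 5)) N] [IsManifold (𝓡 5) ∞ N] [SimplyConnectedSpace N]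
    (g : Bundle.ContMDiffRiemannianMetric (𝓡 5) ∞ (EuclideanSpace ℝ (Fin 5))
      (TangentSpace (𝓡 5) : N → Type _))
    [(PseudoRiemannianMetric.ofRiemannian g).HasLeviCivita]
    (hc : IsGeodesicallyComplete (PseudoRiemannianMetric.ofRiemannian g).leviCivita)
    (hsec : ∀ (x : N) (X Y : TangentSpace (𝓡 5) x), g.inner x X X = 1 → g.inner x Y Y = 1 →
        g.inner x X Y = 0 →
        (PseudoRiemannianMetric.ofRiemannian g).curvatureForm
          (PseudoRiemannianMetric.ofRiemannian g).leviCivita x X Y Y X ≤ 0) :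
    ∀ γ : ℝ → N, IsGeodesic (PseudoRiemannianMetric.ofRiemannian g).leviCivita γ →
      velocity (𝓡 5) γ 0 ≠ 0 → ∀ K : Set N, IsCompact K → ∃ T : ℝ, ∀ t : ℝ, T ≤ t → γ t ∉ K := by
  sorry

/-- **The piece from the two stubs.** The glue is the completeness of conformally compact metrics
(Mazzeo 1988 §1; GGSU 2019 p. 3; landed `SimpleAH.isGeodesicallyComplete_of_conformallyCompact`).
[cite: GrahamEtAl2020, p. 3 and p. 10] -/
theorem HadamardFillingNonTrapping_of
    (h₁ : ∀ (M : Type) [TopologicalSpace M] [T2Space M] [SecondCountableTopology M]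
      [ChartedSpace (EuclideanSpace ℝ (Fin 4)) M] [IsManifold (𝓡 4) ∞ M] [CompactSpace M],
      M ≃ₕ Metric.sphere (0 : EuclideanSpace ℝ (Fin 5)) 1 →
      ∀ (N : Type) [TopologicalSpace N] [T2Space N] [SecondCountableTopology N]
        [ChartedSpace (EuclideanSpace ℝ (Fin 5)) N] [IsManifold (𝓡 5) ∞ N]
        (g : Bundle.ContMDiffRiemannianMetric (𝓡 5) ∞ (EuclideanSpace ℝ (Fin 5))
          (TangentSpace (𝓡 5) : N → Type _))
        [(PseudoRiemannianMetric.ofRiemannian g).HasLeviCivita],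
        (∃ (X : Type) (_ : TopologicalSpace X) (_ : T2Space X) (_ : SecondCountableTopology X)
            (_ : ChartedSpace (EuclideanHalfSpace 5) X) (_ : IsManifold (𝓡∂ 5) ∞ X)
            (_ : CompactSpace X) (_ : ConnectedSpace X) (j : N → X) (ι : M → X) (ρ : X → ℝ)
            (gb : Bundle.ContMDiffRiemannianMetric (𝓡∂ 5) 2 (EuclideanSpace ℝ (Fin 5))
              (TangentSpace (𝓡∂ 5) : X → Type _)),
            Manifold.IsSmoothEmbedding (𝓡 5) (𝓡∂ 5) ∞ j ∧ Set.range j = (𝓡∂ 5).interior X ∧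
            Manifold.IsSmoothEmbedding (𝓡 4) (𝓡∂ 5) ∞ ι ∧ Set.range ι = (𝓡∂ 5).boundary X ∧
            ContMDiff (𝓡∂ 5) 𝓘(ℝ, ℝ) ∞ ρ ∧ (∀ x : X, 0 ≤ ρ x) ∧
            (∀ x : X, ρ x = 0 ↔ x ∈ (𝓡∂ 5).boundary X) ∧
            (∀ y : M, ∃ ν : TangentSpace (𝓡∂ 5) (ι y), gb.inner (ι y) ν ν = 1 ∧
              ∀ v : TangentSpace (𝓡∂ 5) (ι y),
                gb.inner (ι y) ν v = mfderiv (𝓡∂ 5) 𝓘(ℝ, ℝ) ρ (ι y) v) ∧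
            (∀ (x : N) (v w : TangentSpace (𝓡 5) x),
              gb.inner (j x) (mfderiv (𝓡 5) (𝓡∂ 5) j x v) (mfderiv (𝓡 5) (𝓡∂ 5) j x w) =
                ρ (j x) ^ 2 * g.inner x v w)) →
        (∀ (x : N) (X Y : TangentSpace (𝓡 5) x), g.inner x X X = 1 → g.inner x Y Y = 1 →
            g.inner x X Y = 0 →
            (PseudoRiemannianMetric.ofRiemannian g).curvatureForm
              (PseudoRiemannianMetric.ofRiemannian g).leviCivita x X Y Y X ≤ 0) →
        SimplyConnectedSpace N)
    (h₂ : ∀ (N : Type) [TopologicalSpace N] [T2Space N] [SecondCountableTopology N]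
      [ChartedSpace (EuclideanSpace ℝ (Fin 5)) N] [IsManifold (𝓡 5) ∞ N] [SimplyConnectedSpace N]
      (g : Bundle.ContMDiffRiemannianMetric (𝓡 5) ∞ (EuclideanSpace ℝ (Fin 5))
        (TangentSpace (𝓡 5) : N → Type _))
      [(PseudoRiemannianMetric.ofRiemannian g).HasLeviCivita],
      IsGeodesicallyComplete (PseudoRiemannianMetric.ofRiemannian g).leviCivita →
      (∀ (x : N) (X Y : TangentSpace (𝓡 5) x), g.inner x X X = 1 → g.inner x Y Y = 1 →
          g.inner x X Y = 0 →
          (PseudoRiemannianMetric.ofRiemannian g).curvatureForm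
            (PseudoRiemannianMetric.ofRiemannian g).leviCivita x X Y Y X ≤ 0) →
      ∀ γ : ℝ → N, IsGeodesic (PseudoRiemannianMetric.ofRiemannian g).leviCivita γ →
        velocity (𝓡 5) γ 0 ≠ 0 → ∀ K : Set N, IsCompact K →
          ∃ T : ℝ, ∀ t : ℝ, T ≤ t → γ t ∉ K) :
    HadamardFillingNonTrapping := by
  intro M _ _ _ _ _ _ he N _ _ _ _ _ g _ hpack hsec
  -- simple connectivity of the bulk (stub 1)
  haveI : SimplyConnectedSpace N := h₁ M he N g hpack hsec
  -- completeness of the conformally compact metric (landed; any compactified regularity)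
  obtain ⟨X, _, _, _, _, _, _, _, j, ι, ρ, gb, hj, hjr, hι, hιr, hρs, hρ0, hρb, hν, hconf⟩ := hpack
  set G := PseudoRiemannianMetric.ofRiemannian g with hGdef
  have hGr : G.IsRiemannian := isRiemannian_ofRiemannian g
  set Gb := PseudoRiemannianMetric.ofRiemannian gb with hGbdef
  have hGbr : Gb.IsRiemannian := isRiemannian_ofRiemannian gb
  have h2 : (2 : ℕ∞ω) ≤ ∞ := WithTop.coe_le_coe.2 le_top
  have hconf₁ : ∀ (x : N) (v : TangentSpace (𝓡 5) x),
      Gb.val (j x) (mfderiv (𝓡 5) (𝓡∂ 5) j x v)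
        (mfderiv (𝓡 5) (𝓡∂ 5) j x v) = ρ (j x) ^ 2 * G.val x v v :=
    fun x v ↦ hconf x v v
  have hc : IsGeodesicallyComplete G.leviCivita :=
    isGeodesicallyComplete_of_conformallyCompact G h2 hGr Gb hGbr
      (hj.contMDiff.of_le (by simp)) hj.isEmbedding hjr (hρs.of_le (by simp)) hρ0 hρb hconf₁
  -- Hadamard manifolds are non-trapping (stub 2)
  exact h₂ N g hc hsec

/-- The composition applied to the two stubs: the piece, conditionally on them. -/
theorem hadamardFillingNonTrapping_conditional : HadamardFillingNonTrapping :=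
  HadamardFillingNonTrapping_of
    (fun M _ _ _ _ _ _ he N _ _ _ _ _ g _ hpack hsec ↦
      stub_simplyConnected_of_hadamardFilling M he N g hpack hsec)
    (fun N _ _ _ _ _ _ g _ hc hsec ↦ stub_nonTrapping_of_simplyConnected N g hc hsec)

end Summit.SmoothPoincare4.SmoothPoincare4.Cruxes.EinsteinHadamardFillingStandard.GgsuC2Redirect

end
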